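import Summits.HodgeConjecture.HodgeConjecture.Theorems.PadicSemiregularLiftHodgeFermatVarietiesPQUnits
import Summits.HodgeConjecture.HodgeConjecture.Theorems.PadicSemiregularLiftHodgeFermatVarietiesPQPayoff
import Summits.HodgeConjecture.HodgeConjecture.Theorems.PadicSemiregularLiftHodgeFermatVarietiesFiveQClassification
import Summits.HodgeConjecture.HodgeConjecture.Theorems.PadicSemiregularLiftHodgeFermatVarietiesFiveQPayoff
import HarnessLib

/-!
# Level `pq` WITHOUT `p + 2 < q`, I — the refined fibre count: `G ≢ 0 ≢ H` is impossible for `q ≥ 11`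

Part 1 of 5 (Sketch step 1, ll. 34–192). The tree's `PQ.structure_units_pq` assumes `p + 2 < q` at exactly one point (Case 1: `H ≢ 0` is excluded by
`2(q-1) ≤ #supp(o) ≤ 2(p+1)`). This part and the next prove the same conclusion under `5 ≤ p`, `p < q`, `11 ≤ q`, which includes the TWIN levels
`p(p+2)`, `p ≥ 11`. Here: `add_two_le_of_lt`, `two_mul_card_add_ne_zero_ge` and `false_of_both_ne_zero` — if `G ≢ 0 ≢ H` then
`2·#supp(o) + 3AB ≥ 2A(p-1) + 2B(q-1)` with `A = #supp G`, `B = #supp H` even numbers in `[2, q-1]`, `[2, p-1]`; together with `#supp(o) ≤ 2(p+1)`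
this is impossible for `q ≥ 11` (two-case estimate according to the sign of `2p - 2 - 3B`).

PROVENANCE. Cell hodge-nonav (HUMAN RULING D-0038), planner seat p1 g33: chapter ROUTE-P1AF addenda ADD2 ∕ ADD3 (memos `HOME/memos/ROUTE-P1AF-ADD2.md`
d3af0b1bf97b24f6, `…-ADD3.md` 5042c485c3dfa6c1; referee PASS 0∕0: ref g51 REF-P1AF-ADD2.md, REF-P1AF-ADD3.md 5111ed97ffe1fe84), frozen Sketch
`HOME/p1/route/Sketch_P1AF_TWIN_ALL_g33.lean` (sha16 48c9088b216d60cb, 1063 lines, namespace `HodgeNonAV.P1AF.Twin`, farm rc 0 / 0 sorries / axioms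
{propext, Classical.choice, Quot.sound}; re-elaborated 2026-08-28), split into five tree modules `…PQTwinCounting` → `…PQTwinStructure` → `…PQTwinFibre` →
`…PQTwinClassification` → `…PQTwinPayoff` by planner p1 g34 (landing kit HOME/p1/landing/); proof bodies verbatim; docstrings reworded per referee riders
N-ADD2-1 ∕ N-ADD3-1 (hypotheses read `5 ≤ p`, `p < q`, `11 ≤ q` as the theorems carry them; no cell tags; Aoki cites are METHOD attributions — the
statements at the twin levels are not in print). A parallel `T`-family rather than a weakening of the tree's `PQFibre ∕ PQClassification ∕ PQPayoff`
hypothesis `p + 2 < q`, because Theorems files are append-only; an operator refactor may later merge the two spellings.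
Extends line `cancel-by-any-claim-lattice` of crux `HodgeFermatVarieties` (route `PadicSemiregularLift`): land with `--supports stmt-HodgeConjecture-1334`
(or `--supports stmt-HodgeConjecture-19652 --as helper`). No instance, no new notation (Part 5's eight `local notation3` are the line's, verbatim from
`Theorems/PadicSemiregularLiftHodgeFermatVarietiesPQPayoff`), no sorry, no new axiom.
HONEST SCOPE: combinatorics of Hodge `(p+1)`-multisets of `ℤ/pq` and the HC pay-off for the Fermat `(p−1)`-folds `X^{p−1}_{pq}` MODULO the line's named
facts (S0) and stub statements (S2↑, S2↓, S3a, S5) — exactly the hypotheses of the tree's `PQ.hodgeConjectureFor_pq`; Fermat varieties are dominated by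
abelian motives, so this is inside the known (AV) region of the summit; NOTHING here proves the Hodge conjecture.
References (method): N. Aoki, Math. Ann. 266 (1983) Thm A′ (§7), Prop. 2.2 [cite: Aoki1983, Thm. A]; N. Aoki, J. Math. Soc. Japan 39 (1987) §1, Thm 2-1
[cite: Aoki1987, Thm. 2-1]; T. Shioda, Math. Ann. 245 (1979) [cite: Shioda1979PJA, Thm. I].
-/

set_option linter.dupNamespace false
set_option linter.unusedVariables false

noncomputable section

namespace Summit.HodgeConjecture.HodgeConjecture.Theorems.CancelByAnyClaimLattice.PQTwin

open Finset
open Literature.AlgebraicGeometry.HodgeTheory Literature.AlgebraicGeometry.HodgeTheory.FermatCharacter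
open Summit.HodgeConjecture.HodgeConjecture.Theorems.CancelByAnyClaimLattice.FiveQ
open Summit.HodgeConjecture.HodgeConjecture.Theorems.CancelByAnyClaimLattice.PQ
open Summit.HodgeConjecture.HodgeConjecture.Theorems.CancelByAnyClaimLattice

section LevelPQ

variable {p q : ℕ} [Fact p.Prime] [Fact q.Prime]

/-- Two distinct odd primes `p < q` satisfy `p + 2 ≤ q`. [folklore] -/
theorem add_two_le_of_lt (hp : 5 ≤ p) (hpq : p < q) : p + 2 ≤ q := by
  have hpP : p.Prime := Fact.out
  have hqP : q.Prime := Fact.out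
  rcases hpP.eq_two_or_odd' with h | hpo
  · omega
  rcases hqP.eq_two_or_odd' with h | hqo
  · omega
  by_contra hlt
  have hq1 : q = p + 1 := by omega
  rw [hq1] at hqo
  exact (Nat.not_even_iff_odd.mpr hqo) (hpo.add_one)

/-- Level sets of an odd function: for `g ≠ 0`, `2(p-1) ≤ 2·#{a : g + H a ≠ 0} + #{a : H a ≠ 0}`
(the zero set `{H = -g}` injects under negation into `{H ≠ 0} ∖ {H = -g}`). [folklore] -/
theorem two_mul_card_add_ne_zero_ge {H : (ZMod p)ˣ → ℂ} (hH : ∀ a, H (-a) = -H a) {g : ℂ} (hg : g ≠ 0) :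
    2 * (p - 1) ≤ 2 * #(univ.filter fun a : (ZMod p)ˣ ↦ g + H a ≠ 0) + #(univ.filter fun a : (ZMod p)ˣ ↦ H a ≠ 0) := by
  classical
  set Z : Finset (ZMod p)ˣ := univ.filter fun a ↦ g + H a = 0 with hZ
  set SH : Finset (ZMod p)ˣ := univ.filter fun a : (ZMod p)ˣ ↦ H a ≠ 0 with hSH
  have htot : #(univ.filter fun a : (ZMod p)ˣ ↦ g + H a ≠ 0) + #Z = p - 1 := by
    have h := Finset.card_filter_add_card_filter_not (s := (univ : Finset (ZMod p)ˣ)) (fun a ↦ g + H a ≠ 0)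
    simp only [not_not, Finset.card_univ, ZMod.card_units] at h
    rw [hZ]; exact h
  -- `Z` and its negative are disjoint subsets of `SH`
  have hZsub : Z ⊆ SH := by
    intro a ha
    simp only [hZ, hSH, mem_filter, mem_univ, true_and] at ha ⊢
    intro h0; apply hg; rw [← ha, h0, add_zero]
  have hZneg : Z.image (fun a ↦ -a) ⊆ SH := by
    intro x hx
    simp only [mem_image] at hx
    obtain ⟨a, ha, rfl⟩ := hx
    simp only [hSH, mem_filter, mem_univ, true_and, hH, neg_ne_zero]
    exact fun h0 ↦ by
      simp only [hZ, mem_filter, mem_univ, true_and] at ha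
      apply hg; rw [← ha, h0, add_zero]
  have hdisj : Disjoint Z (Z.image fun a ↦ -a) := by
    rw [Finset.disjoint_left]
    intro a ha hmem
    simp only [mem_image] at hmem
    obtain ⟨b, hb, hba⟩ := hmem
    simp only [hZ, mem_filter, mem_univ, true_and] at ha hb
    rw [← hba, hH] at ha
    apply hg
    linear_combination (ha + hb) / 2
  have h2Z : 2 * #Z ≤ #SH := by
    have hcard : #(Z ∪ Z.image fun a ↦ -a) = #Z + #Z := by
      rw [Finset.card_union_of_disjoint hdisj, Finset.card_image_of_injective _ neg_injective]
    have hle : #(Z ∪ Z.image fun a ↦ -a) ≤ #SH := card_le_card (Finset.union_subset hZsub hZneg)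
    omega
  omega

/-- **Case `G ≢ 0 ≢ H` is impossible** for `5 ≤ p < q`, `11 ≤ q`, when `o = G + H` is supported on at most
`2(p+1)` points: refined fibre count `2·#supp(o) + 3AB ≥ 2A(p-1) + 2B(q-1)`. -/
theorem false_of_both_ne_zero (hp : 5 ≤ p) (hpq : p < q) (hq : 11 ≤ q) {s : Multiset (ZMod (p * q))}
    (hA : Multiset.card (s.filter IsUnit) ≤ p + 1)
    {G : (ZMod q)ˣ → ℂ} {H : (ZMod p)ˣ → ℂ} (hG : ∀ b, G (-b) = -G b) (hH : ∀ a, H (-a) = -H a)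
    (ho : ∀ x : (ZMod (p * q))ˣ, (Multiset.count (x : ZMod (p * q)) s : ℂ) - Multiset.count (-(x : ZMod (p * q))) s =
      G (ZMod.unitsMap (dvd_mul_left q p) x) + H (ZMod.unitsMap (dvd_mul_right p q) x))
    (hG0 : ∃ b, G b ≠ 0) (hH0 : ∃ a, H a ≠ 0) : False := by
  classical
  have hpq' : p ≠ q := hpq.ne
  have hsupp_le := card_support_le ho
  set SG : Finset (ZMod q)ˣ := univ.filter fun b ↦ G b ≠ 0 with hSG
  set SH : Finset (ZMod p)ˣ := univ.filter fun a : (ZMod p)ˣ ↦ H a ≠ 0 with hSH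
  set fc : (ZMod q)ˣ → ℕ := fun b ↦ #(univ.filter fun a : (ZMod p)ˣ ↦ G b + H a ≠ 0) with hfc
  -- sizes of the supports
  have hA2 : 2 ≤ #SG := by
    obtain ⟨b₀, hb₀⟩ := hG0
    have hne : b₀ ≠ -b₀ := units_ne_neg (by omega) b₀
    calc 2 = #({b₀, -b₀} : Finset (ZMod q)ˣ) := by rw [card_pair hne]
      _ ≤ #SG := by
        refine card_le_card fun x hx ↦ ?_
        simp only [mem_insert, mem_singleton] at hx
        simp only [hSG, mem_filter, mem_univ, true_and]
        rcases hx with rfl | rfl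
        · exact hb₀
        · rw [hG]; exact neg_ne_zero.mpr hb₀
  have hB2 : 2 ≤ #SH := by
    obtain ⟨a₀, ha₀⟩ := hH0
    have hne : a₀ ≠ -a₀ := units_ne_neg (by omega) a₀
    calc 2 = #({a₀, -a₀} : Finset (ZMod p)ˣ) := by rw [card_pair hne]
      _ ≤ #SH := by
        refine card_le_card fun x hx ↦ ?_
        simp only [mem_insert, mem_singleton] at hx
        simp only [hSH, mem_filter, mem_univ, true_and]
        rcases hx with rfl | rfl
        · exact ha₀
        · rw [hH]; exact neg_ne_zero.mpr ha₀
  have hAle : #SG + #SGᶜ = q - 1 := by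
    rw [Finset.card_add_card_compl, ZMod.card_units q]
  have hBle : #SH ≤ p - 1 := by
    calc #SH ≤ #(univ : Finset (ZMod p)ˣ) := card_le_card (Finset.filter_subset _ _)
      _ = p - 1 := by rw [Finset.card_univ, ZMod.card_units p]
  -- the support of `o`, fibrewise over `(ℤ/q)ˣ`
  have hsupp : #(univ.filter fun x : (ZMod (p * q))ˣ ↦
      G (ZMod.unitsMap (dvd_mul_left q p) x) + H (ZMod.unitsMap (dvd_mul_right p q) x) ≠ 0) = ∑ b, fc b := by
    rw [card_eq_sum_card_fibre]
    refine Finset.sum_congr rfl fun b _ ↦ ?_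
    have h := card_fibre_filter hpq' b (fun a : (ZMod p)ˣ ↦ G b + H a ≠ 0)
    rw [show ((univ.filter fun x : (ZMod (p * q))ˣ ↦
        G (ZMod.unitsMap (dvd_mul_left q p) x) + H (ZMod.unitsMap (dvd_mul_right p q) x) ≠ 0).filter
          fun x ↦ ZMod.unitsMap (dvd_mul_left q p) x = b) =
        univ.filter fun x : (ZMod (p * q))ˣ ↦ ZMod.unitsMap (dvd_mul_left q p) x = b ∧
          G b + H (ZMod.unitsMap (dvd_mul_right p q) x) ≠ 0 by
      ext x
      simp only [mem_filter, mem_univ, true_and]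
      constructor
      · rintro ⟨h1, h2⟩; exact ⟨h2, by rw [← h2]; exact h1⟩
      · rintro ⟨h1, h2⟩; exact ⟨by rw [h1]; exact h2, h1⟩, h]
  -- fibres over the support of `G`: `2(p-1) ≤ 2 fc b + B`
  have hSGfib : ∀ b ∈ SG, 2 * (p - 1) ≤ 2 * fc b + #SH := by
    intro b hb
    simp only [hSG, mem_filter, mem_univ, true_and] at hb
    exact two_mul_card_add_ne_zero_ge hH hb
  -- fibres off the support of `G`: `fc b = B`
  have hSGcfib : ∀ b ∈ SGᶜ, fc b = #SH := by
    intro b hb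
    simp only [hSG, mem_compl, mem_filter, mem_univ, true_and, not_not] at hb
    simp only [hfc, hb, zero_add, hSH]
  have hsum_split : ∑ b, fc b = ∑ b ∈ SG, fc b + ∑ b ∈ SGᶜ, fc b :=
    (Finset.sum_add_sum_compl SG fc).symm
  have h1 : #SG * (2 * (p - 1)) ≤ 2 * ∑ b ∈ SG, fc b + #SG * #SH := by
    calc #SG * (2 * (p - 1)) = ∑ b ∈ SG, 2 * (p - 1) := by rw [Finset.sum_const, smul_eq_mul]
      _ ≤ ∑ b ∈ SG, (2 * fc b + #SH) := Finset.sum_le_sum hSGfib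
      _ = 2 * ∑ b ∈ SG, fc b + #SG * #SH := by
        rw [Finset.sum_add_distrib, Finset.mul_sum, Finset.sum_const, smul_eq_mul]
  have h2 : ∑ b ∈ SGᶜ, fc b = #SGᶜ * #SH := by
    rw [Finset.sum_congr rfl hSGcfib, Finset.sum_const, smul_eq_mul]
  -- bookkeeping in `ℤ`
  have hmain : #SG * (2 * (p - 1)) + 2 * (#SGᶜ * #SH) ≤ 2 * (2 * (p + 1)) + #SG * #SH := by
    have e : 2 * ∑ b, fc b ≤ 2 * (2 * (p + 1)) := by
      rw [← hsupp]; exact Nat.mul_le_mul_left 2 (hsupp_le.trans (Nat.mul_le_mul_left 2 hA))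
    rw [hsum_split, mul_add, h2] at e
    omega
  -- the numerical contradiction: `A(2p-2-3B) + 2B(q-1) ≤ 4(p+1)` is impossible
  have hp1 : 1 ≤ p := by omega
  have hq1 : 1 ≤ q := by omega
  zify [hp1, hq1] at hmain hAle hBle hA2 hB2
  set A : ℤ := (#SG : ℤ) with hAdef
  set Ac : ℤ := (#SGᶜ : ℤ) with hAcdef
  set B : ℤ := (#SH : ℤ) with hBdef
  have hAc : Ac = (q : ℤ) - 1 - A := by linarith
  rw [hAc] at hmain
  rcases le_or_gt (3 * B) (2 * (p : ℤ) - 2) with hcase | hcase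
  · -- `2p - 2 - 3B ≥ 0`: use `A ≥ 2`, `B ≥ 2`
    nlinarith [mul_nonneg (sub_nonneg.mpr hA2) (sub_nonneg.mpr hcase), mul_nonneg (sub_nonneg.mpr hB2) (show (0:ℤ) ≤ (q:ℤ) - 4 by linarith)]
  · -- `2p - 2 - 3B < 0`: use `A ≤ q - 1`, `B ≤ p - 1`, `q ≥ 11`
    have hAq : A ≤ (q : ℤ) - 1 := by
      have : (0 : ℤ) ≤ Ac := by rw [hAcdef]; positivity
      linarith
    nlinarith [mul_nonneg (sub_nonneg.mpr hAq) (sub_nonneg.mpr hcase.le), mul_nonneg (sub_nonneg.mpr hBle) (show (0:ℤ) ≤ (q:ℤ) - 1 by linarith),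
      mul_nonneg (show (0:ℤ) ≤ (q:ℤ) - 11 by linarith) (show (0:ℤ) ≤ (p:ℤ) - 1 by linarith)]

end LevelPQ

end Summit.HodgeConjecture.HodgeConjecture.Theorems.CancelByAnyClaimLattice.PQTwin

end
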